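import Literature.Probability.RandomPlanarGeometry.CollarDomain
import Literature.Topology.PlaneTopology.Crosscut
import HarnessLib

/-!
# Cyclic re-marking of a conformal rectangle; separation of opposite arcs

Topic `Literature/Probability/RandomPlanarGeometry`; family `conformal-planar`. Two elementary
facts about a conformal rectangle `R = (Ω; P₀, P₁, P₂, P₃)` with marks
`0 ≤ m₀ < m₁ < m₂ < m₃ < m₀ + 1` (`MarkedDomain.marks_chain`):

* `MarkedDomain.exists_sep_arcs`: the boundary points with parameters in
  `[m₀ + κ, m₁ - κ] ∪ [m₂ + κ, m₃ - κ]` (`κ > 0`; inner parts of the arcs `0, 2`) keep a positive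
  distance from `R.arc 1 ∪ R.arc 3` — compactness, and injectivity of the boundary loop on a period
  (`JordanDomain.injOn_boundary_Ico`);
* `MarkedDomain.exists_shiftMarks`: the cyclically re-marked rectangle `(Ω; P₁, P₂, P₃, P₀)` exists
  as a `ConformalRectangle` — same carrier, boundary loop re-based at the second mark
  `u ↦ R.boundary (u + m₁)`, marks `(0, m₂ - m₁, m₃ - m₁, m₀ + 1 - m₁)` — and its arcs are those of
  `R` shifted by one (the four-point analogue of `DobrushinDomain.swap` of
  `ChordalReversibility.lean`; stated as an existence theorem, no new definition).

These serve the comparison-rectangle constructions of Bollobás–Riordan, *Percolation* (2006),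
Ch. 7 p. 186 (the "upper" comparison domain is the "lower" one of the re-marked rectangle).

## References

* B. Bollobás, O. Riordan, *Percolation*, Cambridge University Press (2006), Ch. 7 p. 186.
* W. Werner, *Lectures on two-dimensional critical percolation*, IAS/Park City (2007), §3.

## Mathlib / tree

Mathlib: `IsCompact.exists_isMinOn`, `IsClosed.notMem_iff_infDist_pos`, `Set.image_add_const_Icc`,
`Fin.strictMono_iff_lt_succ`. Tree: `PlanarDomains` (`MarkedDomain.arc`, `pt`), `CollarDomain`
(`marks_chain`, `nextMarks_eq`), `Crosscut` (`JordanDomain.injOn_boundary_Ico`).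
-/

noncomputable section

open Set Metric Topology Filter

namespace Literature.Probability.RandomPlanarGeometry

namespace MarkedDomain

/-- **Separation of the inner parts of the arcs `0, 2` from the arcs `1, 3`.** The boundary points
with parameters in `[m₀ + κ, m₁ - κ] ∪ [m₂ + κ, m₃ - κ]` (`κ > 0`) keep a positive distance `d₀`
from `R.arc 1 ∪ R.arc 3` (compactness and injectivity of the boundary loop on a period).
[folklore] -/
theorem exists_sep_arcs (R : ConformalRectangle) {κ : ℝ} (hκ : 0 < κ) :
    ∃ d₀ : ℝ, 0 < d₀ ∧ ∀ u ∈ Icc (R.mark 0 + κ) (R.mark 1 - κ) ∪ Icc (R.mark 2 + κ) (R.mark 3 - κ),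
      ∀ b ∈ R.arc 1 ∪ R.arc 3, d₀ ≤ dist (R.boundary u) b := by
  obtain ⟨h0, h1, h2, h3, h4⟩ := R.marks_chain
  obtain ⟨-, n1, -, n3⟩ := R.nextMarks_eq
  set I : Set ℝ := Icc (R.mark 0 + κ) (R.mark 1 - κ) ∪ Icc (R.mark 2 + κ) (R.mark 3 - κ) with hI
  set K : Set ℂ := R.boundary '' I with hK
  set B : Set ℂ := R.arc 1 ∪ R.arc 3 with hB
  have hKc : IsCompact K := (isCompact_Icc.union isCompact_Icc).image R.continuous_boundary
  have hBc : IsClosed B := (R.isClosed_arc 1).union (R.isClosed_arc 3)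
  -- `K` misses `B`
  have hdisj : ∀ u ∈ I, R.boundary u ∉ B := by
    intro u hu hb
    have huI : u ∈ Ico (R.mark 0) (R.mark 0 + 1) := by
      rcases hu with ⟨ha, hb'⟩ | ⟨ha, hb'⟩ <;> exact ⟨by linarith, by linarith⟩
    have hinj := R.toJordanDomain.injOn_boundary_Ico (R.mark 0)
    rcases hb with ⟨w, hw, hbw⟩ | ⟨w, hw, hbw⟩
    · rw [n1] at hw
      have hwu : w = u := hinj ⟨by linarith [hw.1], by linarith [hw.2]⟩ huI hbw
      rcases hu with ⟨ha, hb'⟩ | ⟨ha, hb'⟩ <;> linarith [hw.1, hw.2]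
    · rw [n3] at hw
      rcases hw.2.eq_or_lt with hw1 | hw1
      · rw [hw1, R.periodic_boundary] at hbw
        have hwu : R.mark 0 = u := hinj ⟨le_rfl, by linarith⟩ huI hbw
        rcases hu with ⟨ha, hb'⟩ | ⟨ha, hb'⟩ <;> linarith
      · have hwu : w = u := hinj ⟨by linarith [hw.1], hw1⟩ huI hbw
        rcases hu with ⟨ha, hb'⟩ | ⟨ha, hb'⟩ <;> linarith [hw.1]
  rcases K.eq_empty_or_nonempty with hKe | hKne
  · refine ⟨1, one_pos, fun u hu b _ => ?_⟩
    have : R.boundary u ∈ K := ⟨u, hu, rfl⟩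
    rw [hKe] at this
    exact this.elim
  obtain ⟨k₀, hk₀, hmin⟩ := hKc.exists_isMinOn hKne (continuous_infDist_pt B).continuousOn
  obtain ⟨u₀, hu₀, rfl⟩ := hk₀
  have hpos : 0 < infDist (R.boundary u₀) B :=
    (hBc.notMem_iff_infDist_pos ⟨R.pt 1, Or.inl (R.pt_mem_arc_self 1)⟩).1 (hdisj u₀ hu₀)
  exact ⟨_, hpos, fun u hu b hb => (hmin (show R.boundary u ∈ K from ⟨u, hu, rfl⟩)).trans (infDist_le_dist_of_mem hb)⟩

/-- **The cyclically re-marked rectangle** `(Ω; P₁, P₂, P₃, P₀)`: same carrier, boundary loop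
re-based at the second mark, marks `(0, m₂ - m₁, m₃ - m₁, m₀ + 1 - m₁)`; its arcs are those of `R`
shifted by one. [folklore] -/
theorem exists_shiftMarks (R : ConformalRectangle) : ∃ R' : ConformalRectangle, R'.carrier = R.carrier ∧
    (∀ u, R'.boundary u = R.boundary (u + R.mark 1)) ∧
    (∀ i, R'.mark i = ![0, R.mark 2 - R.mark 1, R.mark 3 - R.mark 1, R.mark 0 + 1 - R.mark 1] i) ∧
    R'.arc 0 = R.arc 1 ∧ R'.arc 1 = R.arc 2 ∧ R'.arc 2 = R.arc 3 ∧ R'.arc 3 = R.arc 0 := by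
  obtain ⟨h0, h1, h2, h3, h4⟩ := R.marks_chain
  obtain ⟨n0, n1, n2, n3⟩ := R.nextMarks_eq
  have him : ∀ a b : ℝ, (fun u => R.boundary (u + R.mark 1)) '' Icc a b = R.boundary '' Icc (a + R.mark 1) (b + R.mark 1) :=
    fun a b => by
    rw [show (fun u => R.boundary (u + R.mark 1)) = R.boundary ∘ fun u => u + R.mark 1 from rfl, image_comp, image_add_const_Icc]
  let R' : ConformalRectangle :=
    { carrier := R.carrier
      boundary := fun u => R.boundary (u + R.mark 1)
      isOpen := R.isOpen
      isBounded := R.isBounded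
      isConnected := R.isConnected
      continuous_boundary := R.continuous_boundary.comp (continuous_id.add continuous_const)
      periodic_boundary := R.periodic_boundary.add_const _
      injOn_boundary := fun s hs t ht hst => add_right_cancel (R.toJordanDomain.injOn_boundary_Ico (R.mark 1)
        (show s + R.mark 1 ∈ Ico (R.mark 1) (R.mark 1 + 1) from ⟨by linarith [hs.1], by linarith [hs.2]⟩)
        (show t + R.mark 1 ∈ Ico (R.mark 1) (R.mark 1 + 1) from ⟨by linarith [ht.1], by linarith [ht.2]⟩) hst)
      range_boundary := by
        rw [show (fun u => R.boundary (u + R.mark 1)) = R.boundary ∘ fun u => u + R.mark 1 from rfl,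
          (add_right_surjective _).range_comp]
        exact R.range_boundary
      mark := ![0, R.mark 2 - R.mark 1, R.mark 3 - R.mark 1, R.mark 0 + 1 - R.mark 1]
      strictMono_mark := Fin.strictMono_iff_lt_succ.2 fun k => by
        fin_cases k
        · show (0 : ℝ) < R.mark 2 - R.mark 1; linarith
        · show R.mark 2 - R.mark 1 < R.mark 3 - R.mark 1; linarith
        · show R.mark 3 - R.mark 1 < R.mark 0 + 1 - R.mark 1; linarith
      mark_mem := fun k => by
        fin_cases k
        · show (0 : ℝ) ∈ Ico 0 1; exact ⟨le_rfl, one_pos⟩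
        · show R.mark 2 - R.mark 1 ∈ Ico 0 1; exact ⟨by linarith, by linarith⟩
        · show R.mark 3 - R.mark 1 ∈ Ico 0 1; exact ⟨by linarith, by linarith⟩
        · show R.mark 0 + 1 - R.mark 1 ∈ Ico 0 1; exact ⟨by linarith, by linarith⟩ }
  obtain ⟨n0', n1', n2', n3'⟩ := R'.nextMarks_eq
  refine ⟨R', rfl, fun u => rfl, fun i => rfl, ?_, ?_, ?_, ?_⟩
  · show R'.boundary '' Icc (R'.mark 0) (R'.nextMark 0) = R.boundary '' Icc (R.mark 1) (R.nextMark 1)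
    rw [n0', n1]
    show (fun u => R.boundary (u + R.mark 1)) '' Icc 0 (R.mark 2 - R.mark 1) = _
    rw [him]; congr 2 <;> ring
  · show R'.boundary '' Icc (R'.mark 1) (R'.nextMark 1) = R.boundary '' Icc (R.mark 2) (R.nextMark 2)
    rw [n1', n2]
    show (fun u => R.boundary (u + R.mark 1)) '' Icc (R.mark 2 - R.mark 1) (R.mark 3 - R.mark 1) = _
    rw [him]; congr 2 <;> ring
  · show R'.boundary '' Icc (R'.mark 2) (R'.nextMark 2) = R.boundary '' Icc (R.mark 3) (R.nextMark 3)
    rw [n2', n3]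
    show (fun u => R.boundary (u + R.mark 1)) '' Icc (R.mark 3 - R.mark 1) (R.mark 0 + 1 - R.mark 1) = _
    rw [him]; congr 2 <;> ring
  · show R'.boundary '' Icc (R'.mark 3) (R'.nextMark 3) = R.boundary '' Icc (R.mark 0) (R.nextMark 0)
    rw [n3', n0]
    show (fun u => R.boundary (u + R.mark 1)) '' Icc (R.mark 0 + 1 - R.mark 1) (0 + 1) = _
    rw [him]
    have hp : R.boundary = R.boundary ∘ fun u => u + 1 := funext fun u => (R.periodic_boundary u).symm
    conv_rhs => rw [hp, image_comp, image_add_const_Icc]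
    congr 2 <;> ring

end MarkedDomain

end Literature.Probability.RandomPlanarGeometry
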